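import Summits.QuantumFields.YangMills.Theorems.BalabanUVNodesN15PerCubeGreenKnit335Inverse
import HarnessLib

/-!
# N15 = NE2, road (c) — PROGRAMME (PC), (PC-F) «the per-cube KNIT», VIII — THE KERNEL READOUT: the inverse of Bałaban's operator for `U` in the per-cube class (3.35) has MATRIX ENTRIES
# decaying exponentially in the block distance, `|G(z′, z)| ≤ B·e^{−(δ∕16)|B(z′)−B(z)|_T}` (n15-c∕321 read through dag-n15-b's `entry_le_of_hasMaj`) (dag-n15-c g30, n15-c∕323)

Cell `pub-ymgap`, seat `pub-ymgap-dag-n15-c` (generation g30; R134 (a), s1; HUMAN RULING D-0062).  `bears_on: R4∕N15 · K3⁸ SpineGivenEndpointR13SepCoPHV (stmt-QuantumFields-27366)`;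
filed `--kind proof --supports stmt-QuantumFields-27366 --as helper` — COUNT-NEUTRAL.  ONE theorem, 0 `def`, 0 `sorry`; a readout, no new estimate.  Imports BY NAME n15-c∕321
`…PerCubeGreenKnit335Inverse` (★★★★★ `exists_inverse_decay_of_reg335Cube`); dag-n15-b's `DefectKernel.entry_le_of_hasMaj` (block majorant ⟹ entries).  Nothing in the tree is modified.

WHY.  [Balaban1985BackgroundPropagators] Thm 3.1 (3.42) p.397 is printed as a KERNEL bound «|G(U; x, x′)| ≤ O(1)e^{−δ₀|x−x′|}»; the seat's theorems are BLOCK-MAJORANT (`HasMaj`) statements.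
THIS FILE prints n15-c∕321 in the kernel currency: every matrix entry of the inverse `G` of `A_U = Δ_{R_U} + a·Q*(U)Q(U) − D_U(I−R(U))D*_U` (coloured bond functions, sharp unit blocks) is
bounded by `B·e^{−(δ∕16)·dist}` of the blocks of its two arguments — the shape a consumer outside the `HasMaj` calculus reads.

WHAT.  ★★★★ `exists_inverse_kernelDecay_of_reg335Cube` — n15-c∕321's prefix VERBATIM (odd `L ≥ 17`, `a₀, a > 0`, `ι`; `∃ δ B > 0`; `∀ e`; `∃ ε₀ > 0, w₂`; every cover index `k ≥ 1`,
`L^m ≥ w₂`; EVERY unitary site field `U`; `ξ, C > 0`, `C∕ξ, C∕ξ² ≤ ε₀`; `∀ k, Reg335Cube scShift U η □⁺_k ξ C`) ⟹ `∃ G, (∀ z x₂, |G(δ_z)(x₂)| ≤ B·e^{−(δ∕16)|B(x₂)−B(z)|_T}) ∧ G∘A_U = 1 ∧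
A_U∘G = 1`.

HONEST FRAMING ∕ LIMITS.  As n15-c∕321: MODEL carriers and operator (doubled-torus cover `2L·L^m`, one averaging level, uniform weights, one-level staircases, `Q(U)` = main term (125) of
[Balaban1985Averaging] (124), one `ξ`, crude constants; `ε₀, w₂` depend on the coordinate system `e`); the distance is the unit-BLOCK torus distance of the cover, not the print's site
distance scaled by `η` (same thing up to the block scale `L^{−k}·L^k = 1`: shape only).  NOT [Balaban1985BackgroundPropagators] Thm 3.1∕3.3 AS PRINTED; NE2⁺ NOT PRINTED, NOT proved; N15
of record untouched (DISCHARGED AS CONSUMED, p687738); K3⁸ OPEN; counts UNMOVED (typed 28∕28); one finite 𝕋⁴ at fixed ε per index — NOT infinite volume, NOT OS on ℝ⁴, NOT a mass gap,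
NOT Clay.  Restate-immune (no Theses import).
-/

noncomputable section

open scoped BigOperators Matrix Matrix.Norms.L2Operator

namespace Summit.QuantumFields.YangMills.BalabanUVNodes.N15.Gluing

open Real
open Literature.MathematicalPhysics.QuantumFieldTheory.Balaban1983to89
open Literature.MathematicalPhysics.QuantumFieldTheory.Balaban1983to89.B5Prop11Plancherel (Tor fine unitVec)
open Literature.MathematicalPhysics.QuantumFieldTheory.Balaban1983to89.B11SectG (BlockNorm HasMaj)
open Literature.MathematicalPhysics.QuantumFieldTheory.Balaban1983to89.B6Prop26Gluing (mulOp)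
open Literature.MathematicalPhysics.QuantumFieldTheory.Balaban1983to89.B6UnitTorusCarrier (unitTorusGeo)
open Literature.MathematicalPhysics.QuantumFieldTheory.Balaban1983to89.B9Eq335RegularityClasses (Reg335Cube)
open Literature.MathematicalPhysics.QuantumFieldTheory.Balaban1983to89.B9Eq3117Current (gaugeTr)
open Literature.MathematicalPhysics.QuantumFieldTheory.King1986.Torus (blockOf)
open Literature.Barriers.QuantumFields (traceForm)
open Summit.QuantumFields.YangMills.BalabanUVNodes.N15.BackgroundLayer (covLapM)
open Summit.QuantumFields.YangMills.BalabanUVNodes.N15.VectorPiece (bshiftEquiv)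
open Summit.QuantumFields.YangMills.BalabanUVNodes.N15.MatrixSpecies (coordMat liftBlk)
open Summit.QuantumFields.YangMills.BalabanUVNodes.N15.TwoGrid (cubeBlocks)
open Summit.QuantumFields.YangMills.BalabanUVNodes.N15.CurvedSpecies (gaugePair)

variable {d : ℕ} {L : ℕ} [NeZero L]

/-- ★★★★ **KERNEL DECAY OF THE INVERSE OF BAŁABAN's OPERATOR IN THE PER-CUBE CLASS (3.35)** (n15-c∕321 in the kernel currency): under n15-c∕321's hypotheses VERBATIM, there is `G` with
`G∘A_U = 1`, `A_U∘G = 1` and `|G(δ_z)(x₂)| ≤ B·e^{−(δ∕16)|B(x₂)−B(z)|_T}` for all coloured bonds `z, x₂` of the cover — the MODEL analogue of the print's «|G(U; x, x′)| ≤ O(1)e^{−δ₀|x−x′|}».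
[cite: Balaban1985BackgroundPropagators, Thm 3.1 (3.42) p.397 (shape: kernel bound), (3.35) p.396, Thm 3.3 p.399] -/
theorem exists_inverse_kernelDecay_of_reg335Cube (hL : Odd L ∧ 1 < L) (hL17 : 17 ≤ L) {a₀ : ℝ} (ha₀ : 0 < a₀) {a : ℝ} (ha : 0 < a) (ι : Type) [Fintype ι] [DecidableEq ι] :
    ∃ δ B : ℝ, 0 < δ ∧ 0 < B ∧
      ∀ {mm : Type} [Fintype mm] [DecidableEq mm] [Nonempty mm] (e : Matrix mm mm ℂ ≃L[ℝ] (ι → ℝ)), (∀ A B : Matrix mm mm ℂ, traceForm A B = e A ⬝ᵥ e B) →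
      ∃ ε₀ w₂ : ℝ, 0 < ε₀ ∧
      ∀ (mv kk : ℕ), 1 ≤ kk → w₂ ≤ ((L ^ mv : ℕ) : ℝ) →
      ∀ (U : Fin (d + 1) → ScX d L mv kk hL → (Matrix mm mm ℂ)ˣ), (∀ μ x, (U μ x : Matrix mm mm ℂ) ∈ Matrix.unitaryGroup mm ℂ) →
      ∀ (ξ C : ℝ), 0 < ξ → 0 < C → C / ξ ≤ ε₀ → C / ξ ^ 2 ≤ ε₀ →
        (∀ k : Fin (d + 1) → ZMod (2 * L), Reg335Cube (scShift d L mv kk hL) U ((((L ^ kk : ℕ) : ℝ))⁻¹) {x : ScX d L mv kk hL | blockOf (L ^ kk) (cvM d L mv kk hL) x ∈ cubeBlocks (cvM d L mv kk hL) (coverCorner (cvM d L mv kk hL) (L ^ mv) L (L * L ^ mv + 6 * L ^ mv - coverMargin L mv + 1) k) (L * L ^ mv + 16 * L ^ mv + 4)} ξ C) →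
        ∃ G : (CvX d L mv kk hL × ι → ℝ) →ₗ[ℝ] (CvX d L mv kk hL × ι → ℝ),
          (∀ (z x₂ : CvX d L mv kk hL × ι), |G (Pi.single z 1) x₂| ≤ B * Real.exp (-(δ / 16 * (unitTorusGeo L kk (cvM d L mv kk hL)).dist (cvBlk d L mv kk hL x₂.1) (cvBlk d L mv kk hL z.1)))) ∧
          G ∘ₗ (covLapM (bshiftEquiv (cvM d L mv kk hL) (L ^ kk)) ((((L ^ kk : ℕ) : ℝ))⁻¹) (gaugePair (bshiftEquiv (cvM d L mv kk hL) (L ^ kk)) (fun μ x => coordMat e (ContinuousLinearMap.mulLeftRight ℝ (Matrix mm mm ℂ) ((U μ x.1 : Matrix mm mm ℂ)) ((U μ x.1 : Matrix mm mm ℂ))ᴴ))) + (cvNL d L mv kk hL a ι - cvNVq d L mv kk hL a ι e (fun μ x => (U μ x.1 : Matrix mm mm ℂ)) - cvNVr d L mv kk hL a ι e (fun μ x => (U μ x.1 : Matrix mm mm ℂ)))) = LinearMap.id ∧ (covLapM (bshiftEquiv (cvM d L mv kk hL) (L ^ kk)) ((((L ^ kk : ℕ) : ℝ))⁻¹) (gaugePair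 (bshiftEquiv (cvM d L mv kk hL) (L ^ kk)) (fun μ x => coordMat e (ContinuousLinearMap.mulLeftRight ℝ (Matrix mm mm ℂ) ((U μ x.1 : Matrix mm mm ℂ)) ((U μ x.1 : Matrix mm mm ℂ))ᴴ))) + (cvNL d L mv kk hL a ι - cvNVq d L mv kk hL a ι e (fun μ x => (U μ x.1 : Matrix mm mm ℂ)) - cvNVr d L mv kk hL a ι e (fun μ x => (U μ x.1 : Matrix mm mm ℂ)))) ∘ₗ G = LinearMap.id := by
  obtain ⟨δ, B, hδ, hB, H⟩ := exists_inverse_decay_of_reg335Cube (d := d) hL hL17 ha₀ ha ι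
  refine ⟨δ, B, hδ, hB, fun {mm} _ _ _ e he => ?_⟩
  obtain ⟨ε₀, w₂, hε0, H2⟩ := H e he
  refine ⟨ε₀, w₂, hε0, fun mv kk hk hw => ?_⟩
  intro U hU ξ C hξ hC hs hs2 h335
  obtain ⟨G, hG, h1, h2⟩ := H2 mv kk hk hw U hU ξ C hξ hC hs hs2 h335
  have hG' : HasMaj (BlockNorm.ofBlocks (unitTorusGeo L kk (cvM d L mv kk hL)) (liftBlk (cvBlk d L mv kk hL) ι))
      (BlockNorm.ofBlocks (unitTorusGeo L kk (cvM d L mv kk hL)) (liftBlk (cvBlk d L mv kk hL) ι)) G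
      (fun y y' => B * Real.exp (-(δ / 16 * (unitTorusGeo L kk (cvM d L mv kk hL)).dist y y'))) := hG
  refine ⟨G, fun z x₂ => ?_, h1, h2⟩
  exact DefectKernel.entry_le_of_hasMaj (g := unitTorusGeo L kk (cvM d L mv kk hL)) (liftBlk (cvBlk d L mv kk hL) ι) (liftBlk (cvBlk d L mv kk hL) ι) hG' z x₂

end Summit.QuantumFields.YangMills.BalabanUVNodes.N15.Gluing

end
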